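import Summits.KontsevichZagierPeriods.KontsevichZagierPeriods.Theorems.LinRedNormalFormArrangementNormalFormStubRebaseSimpleZeroNestedDiffE1Janus

/-!
# Stub `stub_rebaseSimpleZeroTwo`, part `HPar1` (crux `ArrangementNormalForm`, line `janus-bands`)
— brick `NestedDiffE2Box`

**Boundary divergences** of the literal integrand `K/((y − r)(tᵢ − cᵢ(y))(tⱼ − cⱼ(y)))` (`K ≠ 0`)
of a datum of the interval normal form (`RebaseE1.IsDN`). A coordinate box inside the domain on
which the integrand dominates `κ/|x − c|`, `c` an endpoint of a side of the box, is impossible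
since `∫ dx/|x − c| = ∞` (`RebaseE2.not_integrableOn_box`, `RebaseE2.box_diverge`). Consequences:
`RebaseE2.pinch_left` / `RebaseE2.pinch_right` (if the base pole is an END of the interval the band
pinches there, `A = B` at that end), `RebaseE2.top_ne_outer` (a constant outer letter is not the
constant top).
Registered: `rebaseSimpleZero_e2PinchLeft`.

References: M. Kontsevich, D. Zagier, *Periods* (2001), §1.2; D. Zagier, *Values of zeta functions
and their applications* (1994), §9.
-/

noncomputable section

open Set MeasureTheory MvPolynomial
open Literature.NumberTheory.Transcendental Literature.ModelTheory.ExponentialFields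

namespace Summit.KontsevichZagierPeriods.ArrangementNormalForm.JanusBands

namespace RebaseE2

open SeparatePos RebasePos RebaseZero RebaseNest RebaseDiff RebaseE1

/-! ### Box divergence -/

/-- `x ↦ |x − c|⁻¹` is not integrable on an open interval with `c` as an endpoint. -/
theorem not_integrableOn_abs_sub_inv {a b c : ℝ} (hab : a < b) (hc : c = a ∨ c = b) :
    ¬ IntegrableOn (fun x : ℝ => |x - c|⁻¹) (Ioo a b) := by
  intro h
  have h4 : IntervalIntegrable (fun x : ℝ => (x - c)⁻¹) volume a b := by
    rw [intervalIntegrable_iff_integrableOn_Ioo_of_le hab.le]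
    refine (integrable_norm_iff ?_).1 ?_
    · exact (measurable_inv.comp (measurable_id.sub_const c)).aestronglyMeasurable
    · have e : (fun x : ℝ => ‖(x - c)⁻¹‖) = fun x => |x - c|⁻¹ := by ext x; simp [Real.norm_eq_abs]
      rw [e]; exact h
  rcases intervalIntegrable_sub_inv_iff.1 h4 with h' | h'
  · exact absurd h' hab.ne
  · refine h' ?_
    rw [uIcc_of_le hab.le]
    rcases hc with rfl | rfl
    · exact ⟨le_rfl, hab.le⟩
    · exact ⟨hab.le, le_rfl⟩

/-- **Box divergence.** On the open coordinate box `S = ∏ₖ (loₖ, hiₖ)` let `|f| ≥ κ/|wₖ₀ − c|`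
with `κ > 0` and `c` an endpoint of the `k₀`-th side. Then `f` is not absolutely integrable on `S`
(`∫ dx/|x − c| = ∞` next to `c`). [Zagier 1994, §9] -/
theorem not_integrableOn_box {n : ℕ} (lo hi : Fin n → ℝ) (hlt : ∀ k, lo k < hi k) (k₀ : Fin n) (c κ : ℝ)
    (hκ : 0 < κ) (hc : c = lo k₀ ∨ c = hi k₀) {f : (Fin n → ℝ) → ℝ}
    (hb : ∀ w ∈ Set.pi univ (fun k => Ioo (lo k) (hi k)), κ / |w k₀ - c| ≤ |f w|) :
    ¬ IntegrableOn f (Set.pi univ fun k => Ioo (lo k) (hi k)) := by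
  intro hf
  set I : Fin n → Set ℝ := fun k => Ioo (lo k) (hi k) with hI
  have hSm : MeasurableSet (Set.pi univ I) := MeasurableSet.univ_pi fun _ => measurableSet_Ioo
  have hm1 : Measurable fun x : ℝ => (|x - c|)⁻¹ :=
    (continuous_abs.measurable.comp (measurable_id.sub_const c)).inv
  have hae : ∀ᵐ w ∂(volume.restrict (Set.pi univ I)), ‖(|w k₀ - c|)⁻¹‖ ≤ κ⁻¹ * ‖f w‖ := by
    filter_upwards [ae_restrict_mem hSm] with w hw
    have hk : w k₀ ∈ Ioo (lo k₀) (hi k₀) := hw k₀ (mem_univ _)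
    have hne : w k₀ - c ≠ 0 := by
      rcases hc with rfl | rfl
      · exact sub_ne_zero.2 hk.1.ne'
      · exact sub_ne_zero.2 hk.2.ne
    have hpos : 0 < |w k₀ - c| := abs_pos.2 hne
    rw [Real.norm_eq_abs, Real.norm_eq_abs, abs_inv, abs_abs]
    calc (|w k₀ - c|)⁻¹ = κ⁻¹ * (κ / |w k₀ - c|) := by field_simp
      _ ≤ κ⁻¹ * |f w| := mul_le_mul_of_nonneg_left (hb w hw) (inv_nonneg.2 hκ.le)
  have h2 : IntegrableOn (fun w : Fin n → ℝ => (|w k₀ - c|)⁻¹) (Set.pi univ I) :=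
    Integrable.mono' (hf.norm.const_mul _) ((hm1.comp (measurable_pi_apply _)).aestronglyMeasurable) hae
  have h3 : IntegrableOn (fun x : ℝ => (|x - c|)⁻¹) (I k₀) := by
    refine unletter_integrableOn_pi _ I k₀ _ hm1 (fun k => ?_) (fun k => ?_) h2
    · simp only [hI, Real.volume_Ioo]; rw [ENNReal.ofReal_ne_zero_iff]; linarith [hlt k]
    · simp only [hI, Real.volume_Ioo]; exact ENNReal.ofReal_ne_top
  exact not_integrableOn_abs_sub_inv (hlt k₀) hc h3

/-! ### Coordinate boxes in the three-space -/

variable {i j : Fin 2}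

/-- The coordinate box `{ylo < y < yhi, a₁ < tᵢ < b₁, a₂ < tⱼ < b₂}` as a `Set.pi`, and its
coordinates. -/
theorem mem_box3 (hij : i ≠ j) (ylo yhi a₁ b₁ a₂ b₂ : ℝ) (w : Fin (0 + 1 + 2) → ℝ) :
    w ∈ Set.pi univ (fun k => Ioo
      (Function.update (Function.update (fun _ : Fin (0 + 1 + 2) => ylo) (tIdx i) a₁) (tIdx j) a₂ k)
      (Function.update (Function.update (fun _ : Fin (0 + 1 + 2) => yhi) (tIdx i) b₁) (tIdx j) b₂ k)) ↔
    (ylo < yv w ∧ yv w < yhi) ∧ (a₁ < tv w i ∧ tv w i < b₁) ∧ (a₂ < tv w j ∧ tv w j < b₂) := by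
  simp only [mem_pi, mem_univ, true_imp_iff, mem_Ioo]
  constructor
  · intro h
    have hy := h (yIdx 2)
    have h1 := h (tIdx i)
    have h2 := h (tIdx j)
    rw [Function.update_of_ne (yIdx_ne_tIdx j), Function.update_of_ne (yIdx_ne_tIdx i),
      Function.update_of_ne (yIdx_ne_tIdx j), Function.update_of_ne (yIdx_ne_tIdx i)] at hy
    rw [Function.update_of_ne (tIdx_injective.ne hij), Function.update_self,
      Function.update_of_ne (tIdx_injective.ne hij), Function.update_self] at h1
    rw [Function.update_self, Function.update_self] at h2
    exact ⟨hy, h1, h2⟩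
  · rintro ⟨hy, h1, h2⟩ k
    rcases idx_cases k with rfl | ⟨l, rfl⟩
    · rw [Function.update_of_ne (yIdx_ne_tIdx j), Function.update_of_ne (yIdx_ne_tIdx i),
        Function.update_of_ne (yIdx_ne_tIdx j), Function.update_of_ne (yIdx_ne_tIdx i)]
      exact hy
    · rcases fin_two_eq_or hij l with rfl | rfl
      · rw [Function.update_of_ne (tIdx_injective.ne hij), Function.update_self,
          Function.update_of_ne (tIdx_injective.ne hij), Function.update_self]
        exact h1
      · rw [Function.update_self, Function.update_self]
        exact h2

/-- The letter forms are bounded on a bounded set. -/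
theorem exists_letter_bound_set {D : Set (Fin (0 + 1 + 2) → ℝ)} (hbd : Bornology.IsBounded D) (l : Fin 2)
    (c : Cf) : ∃ P : ℝ, 0 < P ∧ ∀ z ∈ D, |tv z l - ev c (yv z)| ≤ P := by
  obtain ⟨Rb, hRb⟩ := hbd.exists_norm_le
  have hR0 : 0 ≤ max Rb 0 := le_max_right _ _
  refine ⟨max Rb 0 + (|(c.1 (Fin.last 0) : ℝ)| * max Rb 0 + |(c.2 : ℝ)|) + 1, by positivity, fun z hz => ?_⟩
  have hz1 : |tv z l| ≤ max Rb 0 :=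
    ((norm_le_pi_norm z (tIdx l)).trans ((hRb z hz).trans (le_max_left _ _)))
  have hz2 : |yv z| ≤ max Rb 0 :=
    ((norm_le_pi_norm z (yIdx 2)).trans ((hRb z hz).trans (le_max_left _ _)))
  have h3 : |ev c (yv z)| ≤ |(c.1 (Fin.last 0) : ℝ)| * |yv z| + |(c.2 : ℝ)| := by
    rw [ev]
    calc |(c.1 (Fin.last 0) : ℝ) * yv z + c.2| ≤ |(c.1 (Fin.last 0) : ℝ) * yv z| + |(c.2 : ℝ)| := abs_add_le _ _
      _ = |(c.1 (Fin.last 0) : ℝ)| * |yv z| + |(c.2 : ℝ)| := by rw [abs_mul]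
  have h4 : |(c.1 (Fin.last 0) : ℝ)| * |yv z| ≤ |(c.1 (Fin.last 0) : ℝ)| * max Rb 0 :=
    mul_le_mul_of_nonneg_left hz2 (abs_nonneg (c.1 (Fin.last 0) : ℝ))
  calc |tv z l - ev c (yv z)| ≤ |tv z l| + |ev c (yv z)| := abs_sub _ _
    _ ≤ max Rb 0 + (|(c.1 (Fin.last 0) : ℝ)| * max Rb 0 + |(c.2 : ℝ)|) + 1 := by linarith

/-- The base form is bounded on a bounded set. -/
theorem exists_base_bound_set {D : Set (Fin (0 + 1 + 2) → ℝ)} (hbd : Bornology.IsBounded D) (r : ℚ) :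
    ∃ P : ℝ, 0 < P ∧ ∀ z ∈ D, |yv z - r| ≤ P := by
  obtain ⟨Rb, hRb⟩ := hbd.exists_norm_le
  have hR0 : 0 ≤ max Rb 0 := le_max_right _ _
  refine ⟨max Rb 0 + |(r : ℝ)| + 1, by positivity, fun z hz => ?_⟩
  have hz2 : |yv z| ≤ max Rb 0 :=
    ((norm_le_pi_norm z (yIdx 2)).trans ((hRb z hz).trans (le_max_left _ _)))
  calc |yv z - r| ≤ |yv z| + |(r : ℝ)| := abs_sub _ _
    _ ≤ max Rb 0 + |(r : ℝ)| + 1 := by linarith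

/-- **A box in the domain makes the integrand diverge at two boundary configurations.** If the
literal integrand (`K ≠ 0`, simple base pole `r`, letters `cᵢ, cⱼ`) is absolutely integrable on a
bounded set `D` on which neither letter plane nor the base pole is met, and `D` contains the
non-degenerate coordinate box `{ylo < y < yhi} × {a₁ < tᵢ < b₁} × {a₂ < tⱼ < b₂}`, then `r` is not
an end of `(ylo, yhi)` and, if the outer letter is the constant `κ`, `κ` is not an end of
`(a₂, b₂)`. [Zagier 1994, §9] -/
theorem box_diverge (hij : i ≠ j) {D : Set (Fin (0 + 1 + 2) → ℝ)} (hbd : Bornology.IsBounded D)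
    (T : BData) (p : MvPolynomial (Fin 0) ℚ) (a : Fin 2 → Option Cf) (ci cj : Cf) (hi : a i = some ci)
    (hj : a j = some cj) (h1 : T.n₁ = 0) (hn : T.n₂ = 1) (hK : Kc T p ≠ 0)
    (hint : IntegrableOn (glitB T p a) D) (hnei : ∀ z ∈ D, tv z i ≠ ev ci (yv z))
    (hnej : ∀ z ∈ D, tv z j ≠ ev cj (yv z)) (hy : ∀ z ∈ D, yv z ≠ T.ℓ₂.2)
    (ylo yhi a₁ b₁ a₂ b₂ : ℝ) (hylt : ylo < yhi) (h1lt : a₁ < b₁) (h2lt : a₂ < b₂)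
    (hsub : ∀ w : Fin (0 + 1 + 2) → ℝ, (ylo < yv w ∧ yv w < yhi) → (a₁ < tv w i ∧ tv w i < b₁) →
      (a₂ < tv w j ∧ tv w j < b₂) → w ∈ D) :
    ((T.ℓ₂.2 : ℝ) ≠ ylo ∧ (T.ℓ₂.2 : ℝ) ≠ yhi) ∧
      (cj.1 (Fin.last 0) = 0 → (cj.2 : ℝ) ≠ a₂ ∧ (cj.2 : ℝ) ≠ b₂) := by
  set r : ℚ := T.ℓ₂.2 with hr
  -- the box
  set lo : Fin (0 + 1 + 2) → ℝ :=
    Function.update (Function.update (fun _ : Fin (0 + 1 + 2) => ylo) (tIdx i) a₁) (tIdx j) a₂ with hlo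
  set hi' : Fin (0 + 1 + 2) → ℝ :=
    Function.update (Function.update (fun _ : Fin (0 + 1 + 2) => yhi) (tIdx i) b₁) (tIdx j) b₂ with hhi'
  have mS := fun w => mem_box3 hij ylo yhi a₁ b₁ a₂ b₂ w
  have hloy : lo (yIdx 2) = ylo := by
    simp only [hlo, Function.update_of_ne (yIdx_ne_tIdx j), Function.update_of_ne (yIdx_ne_tIdx i)]
  have hhiy : hi' (yIdx 2) = yhi := by
    simp only [hhi', Function.update_of_ne (yIdx_ne_tIdx j), Function.update_of_ne (yIdx_ne_tIdx i)]
  have hloi : lo (tIdx i) = a₁ := by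
    simp only [hlo, Function.update_of_ne (tIdx_injective.ne hij), Function.update_self]
  have hhii : hi' (tIdx i) = b₁ := by
    simp only [hhi', Function.update_of_ne (tIdx_injective.ne hij), Function.update_self]
  have hloj : lo (tIdx j) = a₂ := by simp only [hlo, Function.update_self]
  have hhij : hi' (tIdx j) = b₂ := by simp only [hhi', Function.update_self]
  have hlt : ∀ k, lo k < hi' k := fun k => by
    rcases idx_cases k with rfl | ⟨l, rfl⟩
    · rw [hloy, hhiy]; exact hylt
    · rcases fin_two_eq_or hij l with rfl | rfl
      · rw [hloi, hhii]; exact h1lt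
      · rw [hloj, hhij]; exact h2lt
  have hSD : Set.pi univ (fun k => Ioo (lo k) (hi' k)) ⊆ D := fun w hw => by
    obtain ⟨h0, h1', h2'⟩ := (mS w).1 hw
    exact hsub w h0 h1' h2'
  have hintS : IntegrableOn (glitB T p a) (Set.pi univ fun k => Ioo (lo k) (hi' k)) := hint.mono_set hSD
  -- bounds of the three forms on `D`
  obtain ⟨Py, hPy, hPyle⟩ := exists_base_bound_set hbd r
  obtain ⟨Pi, hPi, hPile⟩ := exists_letter_bound_set hbd i ci
  obtain ⟨Pj, hPj, hPjle⟩ := exists_letter_bound_set hbd j cj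
  have hK' : 0 < |Kc T p| := abs_pos.2 hK
  have hf_abs : ∀ z ∈ D, |glitB T p a z| = |Kc T p| * (1 / |yv z - r|) *
      ((1 / |tv z i - ev ci (yv z)|) * (1 / |tv z j - ev cj (yv z)|)) := fun z _ => by
    rw [glitB_two T p a hij ci cj hi hj h1 hn]; simp only [abs_mul, abs_div, abs_one, hr]
  -- the two lower bounds
  have hboundY : ∀ w ∈ D, |Kc T p| / (Pi * Pj) / |yv w - r| ≤ |glitB T p a w| := fun w hw => by
    have hyr : 0 < |yv w - r| := abs_pos.2 (sub_ne_zero.2 (hy w hw))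
    have hti : 0 < |tv w i - ev ci (yv w)| := abs_pos.2 (sub_ne_zero.2 (hnei w hw))
    have htj : 0 < |tv w j - ev cj (yv w)| := abs_pos.2 (sub_ne_zero.2 (hnej w hw))
    have e2 : 1 / Pi ≤ 1 / |tv w i - ev ci (yv w)| := one_div_le_one_div_of_le hti (hPile w hw)
    have e3 : 1 / Pj ≤ 1 / |tv w j - ev cj (yv w)| := one_div_le_one_div_of_le htj (hPjle w hw)
    have e : |Kc T p| / (Pi * Pj) / |yv w - r| = |Kc T p| * (1 / |yv w - r|) * ((1 / Pi) * (1 / Pj)) := by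
      field_simp
    rw [hf_abs w hw, e]
    exact mul_le_mul_of_nonneg_left (mul_le_mul e2 e3 (by positivity) (by positivity)) (by positivity)
  have hboundJ : ∀ w ∈ D, |Kc T p| / (Py * Pi) / |tv w j - ev cj (yv w)| ≤ |glitB T p a w| := fun w hw => by
    have hyr : 0 < |yv w - r| := abs_pos.2 (sub_ne_zero.2 (hy w hw))
    have hti : 0 < |tv w i - ev ci (yv w)| := abs_pos.2 (sub_ne_zero.2 (hnei w hw))
    have htj : 0 < |tv w j - ev cj (yv w)| := abs_pos.2 (sub_ne_zero.2 (hnej w hw))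
    have e1 : 1 / Py ≤ 1 / |yv w - r| := one_div_le_one_div_of_le hyr (hPyle w hw)
    have e2 : 1 / Pi ≤ 1 / |tv w i - ev ci (yv w)| := one_div_le_one_div_of_le hti (hPile w hw)
    have e : |Kc T p| / (Py * Pi) / |tv w j - ev cj (yv w)| =
        |Kc T p| * (1 / Py) * ((1 / Pi) * (1 / |tv w j - ev cj (yv w)|)) := by
      field_simp
    rw [hf_abs w hw, e]
    exact mul_le_mul (mul_le_mul_of_nonneg_left e1 (by positivity))
      (mul_le_mul_of_nonneg_right e2 (by positivity)) (by positivity) (by positivity)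
  refine ⟨⟨fun h => ?_, fun h => ?_⟩, fun hcj => ?_⟩
  · exact not_integrableOn_box lo hi' hlt (yIdx 2) (r : ℝ) (|Kc T p| / (Pi * Pj)) (by positivity)
      (Or.inl (h.trans hloy.symm)) (fun w hw => hboundY w (hSD hw)) hintS
  · exact not_integrableOn_box lo hi' hlt (yIdx 2) (r : ℝ) (|Kc T p| / (Pi * Pj)) (by positivity)
      (Or.inr (h.trans hhiy.symm)) (fun w hw => hboundY w (hSD hw)) hintS
  · have hcjv : ∀ y : ℝ, ev cj y = cj.2 := fun y => by rw [ev, hcj, Rat.cast_zero, zero_mul, zero_add]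
    have hb' : ∀ w ∈ Set.pi univ (fun k => Ioo (lo k) (hi' k)), |Kc T p| / (Py * Pi) / |w (tIdx j) - cj.2| ≤
        |glitB T p a w| := fun w hw => by
      have := hboundJ w (hSD hw)
      rwa [hcjv] at this
    refine ⟨fun h => ?_, fun h => ?_⟩
    · exact not_integrableOn_box lo hi' hlt (tIdx j) (cj.2 : ℝ) (|Kc T p| / (Py * Pi)) (by positivity)
        (Or.inl (h.trans hloj.symm)) hb' hintS
    · exact not_integrableOn_box lo hi' hlt (tIdx j) (cj.2 : ℝ) (|Kc T p| / (Py * Pi)) (by positivity)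
        (Or.inr (h.trans hhij.symm)) hb' hintS

/-! ### Consequences for a datum of the interval normal form -/

variable {s : KZ.IntegralRep (0 + 1 + 2)} {l u : ℚ} {A B : Cf} {T : BData} {p : MvPolynomial (Fin 0) ℚ}
  {a : Fin 2 → Option Cf} {ci cj : Cf}

/-- **Box divergence for a datum.** For a datum of `HDiff₁` with letters `cᵢ, cⱼ` and non-zero
base constant: if the domain contains the coordinate box `{y₁ < y < y₂} × {a₁ < tᵢ < b₁} ×
{a₂ < tⱼ < b₂}` (`l ≤ y₁ < y₂ ≤ u`, `A ≤ a₁ < b₁ ≤ a₂ < b₂ ≤ B` over `(y₁, y₂)`), then the base pole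
is not an end of `(y₁, y₂)`, and a constant outer letter is not an end of `(a₂, b₂)`.
[Zagier 1994, §9] -/
theorem isDN_box (h : IsDN s l u A B T p a i j) (hi : a i = some ci) (hj : a j = some cj) (h1 : T.n₁ = 0)
    (hn : T.n₂ = 1) (hK : Kc T p ≠ 0) {y₁ y₂ a₁ b₁ a₂ b₂ : ℝ} (hly : (l : ℝ) ≤ y₁) (hyy : y₁ < y₂)
    (hyu : y₂ ≤ u) (hA : ∀ y : ℝ, y₁ < y → y < y₂ → ev A y ≤ a₁) (h1lt : a₁ < b₁) (h12 : b₁ ≤ a₂)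
    (h2lt : a₂ < b₂) (hB : ∀ y : ℝ, y₁ < y → y < y₂ → b₂ ≤ ev B y) :
    ((T.ℓ₂.2 : ℝ) ≠ y₁ ∧ (T.ℓ₂.2 : ℝ) ≠ y₂) ∧ (cj.1 (Fin.last 0) = 0 → (cj.2 : ℝ) ≠ a₂ ∧ (cj.2 : ℝ) ≠ b₂) := by
  have hij := h.ne
  have hI : IntegrableOn (glitB T p a) s.domain := by rw [h.dom]; exact h.integrableOn
  obtain ⟨hnei, hnej⟩ := letter_ne_of_integrableOn hij _ A B T p a ci cj hi hj h1 hn hK h.integrableOn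
  rw [← h.dom] at hnei hnej
  refine box_diverge hij h.bdd T p a ci cj hi hj h1 hn hK hI hnei hnej
    (fun z hz => h.yv_ne ((h.mem z).1 hz).1.1 ((h.mem z).1 hz).1.2) y₁ y₂ a₁ b₁ a₂ b₂ hyy h1lt h2lt
    fun w hw hwi hwj => ?_
  rw [h.mem]
  have hAw := hA _ hw.1 hw.2
  have hBw := hB _ hw.1 hw.2
  exact ⟨⟨lt_of_le_of_lt hly hw.1, lt_of_lt_of_le hw.2 hyu⟩, by linarith, by linarith, by linarith⟩

/-- A slope times a small enough step is small: `|α| δ ≤ d/8` for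
`δ ≤ d/(8 (|α| + |β| + 1))`. -/
theorem slope_step_le {α β d δ : ℝ} (hd : 0 < d) (hδ0 : 0 ≤ δ) (hδ : δ ≤ d / (8 * (|α| + |β| + 1))) :
    |α| * δ ≤ d / 8 := by
  have hS : 0 < |α| + |β| + 1 := by positivity
  calc |α| * δ ≤ |α| * (d / (8 * (|α| + |β| + 1))) := mul_le_mul_of_nonneg_left hδ (abs_nonneg α)
    _ ≤ d / 8 := by
        rw [mul_div_assoc', div_le_div_iff₀ (by positivity) (by norm_num : (0 : ℝ) < 8)]
        have h0 : 0 ≤ δ := hδ0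
        nlinarith [abs_nonneg α, abs_nonneg β]

/-- **Pinch at the left end.** If the base pole is the left end `l` of the interval (non-zero base
constant), the band pinches there: `A(l) = B(l)` (else a box `{l < y < l + δ} × …` inside the
domain carries `|f| ≥ κ/|y − l|`). [Zagier 1994, §9] -/
theorem pinch_left (h : IsDN s l u A B T p a i j) (hi : a i = some ci) (hj : a j = some cj) (h1 : T.n₁ = 0)
    (hn : T.n₂ = 1) (hK : Kc T p ≠ 0) (hr : T.ℓ₂.2 = l) : ev A l = ev B l := by
  have hlu : (l : ℝ) < u := by exact_mod_cast h.lu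
  have hle : ev A l ≤ ev B l := by
    have := nonneg_left_end (B - A) h.lu fun y hy1 hy2 => by rw [ev_sub]; linarith [h.AB y hy1 hy2]
    rw [ev_sub] at this; linarith
  by_contra hne
  have hlt : ev A l < ev B l := lt_of_le_of_ne hle hne
  set d : ℝ := ev B l - ev A l with hd
  have hd0 : 0 < d := by rw [hd]; linarith
  set α : ℝ := (A.1 (Fin.last 0) : ℝ) with hα
  set β : ℝ := (B.1 (Fin.last 0) : ℝ) with hβ
  set δ : ℝ := min ((u : ℝ) - l) (d / (8 * (|α| + |β| + 1))) with hδ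
  have hδ0 : 0 < δ := lt_min (by linarith) (by positivity)
  have hδ1 : δ ≤ (u : ℝ) - l := min_le_left _ _
  have hδ2 : δ ≤ d / (8 * (|α| + |β| + 1)) := min_le_right _ _
  have hαδ : |α| * δ ≤ d / 8 := slope_step_le hd0 hδ0.le hδ2
  have hβδ : |β| * δ ≤ d / 8 := slope_step_le hd0 hδ0.le (by rwa [add_comm |α| |β|] at hδ2)
  have key := (isDN_box h hi hj h1 hn hK (y₁ := l) (y₂ := l + δ) (a₁ := ev A l + d / 4) (b₁ := ev A l + 3 * d / 8)
    (a₂ := ev A l + d / 2) (b₂ := ev A l + 3 * d / 4) le_rfl (by linarith) (by linarith)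
    (fun y hy1 hy2 => ?_) (by linarith) (by linarith) (by linarith) (fun y hy1 hy2 => ?_)).1.1
  · exact key (by exact_mod_cast hr)
  · have hyy : |y - l| ≤ δ := by rw [abs_of_pos (by linarith)]; linarith
    have := ev_sub_ev_le A hyy
    linarith
  · have hyy : |(l : ℝ) - y| ≤ δ := by rw [abs_of_neg (by linarith)]; linarith
    have := ev_sub_ev_le B hyy
    linarith

/-- **Pinch at the right end.** If the base pole is the right end `u` of the interval (non-zero
base constant), the band pinches there: `A(u) = B(u)`. [Zagier 1994, §9] -/
theorem pinch_right (h : IsDN s l u A B T p a i j) (hi : a i = some ci) (hj : a j = some cj) (h1 : T.n₁ = 0)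
    (hn : T.n₂ = 1) (hK : Kc T p ≠ 0) (hr : T.ℓ₂.2 = u) : ev A u = ev B u := by
  have hlu : (l : ℝ) < u := by exact_mod_cast h.lu
  have hle : ev A u ≤ ev B u := by
    have := nonneg_right_end (B - A) h.lu fun y hy1 hy2 => by rw [ev_sub]; linarith [h.AB y hy1 hy2]
    rw [ev_sub] at this; linarith
  by_contra hne
  have hlt : ev A u < ev B u := lt_of_le_of_ne hle hne
  set d : ℝ := ev B u - ev A u with hd
  have hd0 : 0 < d := by rw [hd]; linarith
  set α : ℝ := (A.1 (Fin.last 0) : ℝ) with hα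
  set β : ℝ := (B.1 (Fin.last 0) : ℝ) with hβ
  set δ : ℝ := min ((u : ℝ) - l) (d / (8 * (|α| + |β| + 1))) with hδ
  have hδ0 : 0 < δ := lt_min (by linarith) (by positivity)
  have hδ1 : δ ≤ (u : ℝ) - l := min_le_left _ _
  have hδ2 : δ ≤ d / (8 * (|α| + |β| + 1)) := min_le_right _ _
  have hαδ : |α| * δ ≤ d / 8 := slope_step_le hd0 hδ0.le hδ2
  have hβδ : |β| * δ ≤ d / 8 := slope_step_le hd0 hδ0.le (by rwa [add_comm |α| |β|] at hδ2)
  have key := (isDN_box h hi hj h1 hn hK (y₁ := u - δ) (y₂ := u) (a₁ := ev A u + d / 4) (b₁ := ev A u + 3 * d / 8)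
    (a₂ := ev A u + d / 2) (b₂ := ev A u + 3 * d / 4) (by linarith) (by linarith) le_rfl
    (fun y hy1 hy2 => ?_) (by linarith) (by linarith) (by linarith) (fun y hy1 hy2 => ?_)).1.2
  · exact key (by exact_mod_cast hr)
  · have hyy : |y - u| ≤ δ := by rw [abs_of_neg (by linarith)]; linarith
    have := ev_sub_ev_le A hyy
    linarith
  · have hyy : |(u : ℝ) - y| ≤ δ := by rw [abs_of_pos (by linarith)]; linarith
    have := ev_sub_ev_le B hyy
    linarith

/-- **A constant outer letter is not the constant top.** For a datum with constant top `τ`, a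
constant outer letter `κ` and non-zero base constant, `κ ≠ τ` (else a box `… × {τ − δ < tⱼ < τ}`
inside the domain carries `|f| ≥ κ₀/|tⱼ − τ|`). [Zagier 1994, §9] -/
theorem top_ne_outer {τ : ℚ} (h : IsDN s l u A (mk 0 τ) T p a i j) (hi : a i = some ci) (hj : a j = some cj)
    (hcj : cj.1 (Fin.last 0) = 0) (h1 : T.n₁ = 0) (hn : T.n₂ = 1) (hK : Kc T p ≠ 0) : (cj.2 : ℝ) ≠ τ := by
  intro hκ
  have hlu : (l : ℝ) < u := by exact_mod_cast h.lu
  have hτ : ∀ y : ℝ, ev (mk 0 τ) y = τ := fun y => by rw [ev_mk, Rat.cast_zero, zero_mul, zero_add]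
  -- a middle sub-interval with rational ends
  set y₁ : ℚ := (2 * l + u) / 3 with hy₁
  set y₂ : ℚ := (l + 2 * u) / 3 with hy₂
  have hly : (l : ℝ) < y₁ := by rw [hy₁]; push_cast; linarith
  have hyy : y₁ < y₂ := by rw [hy₁, hy₂]; linarith [h.lu]
  have hyy' : (y₁ : ℝ) < y₂ := by exact_mod_cast hyy
  have hyu : (y₂ : ℝ) < u := by rw [hy₂]; push_cast; linarith
  set Am : ℝ := max (ev A y₁) (ev A y₂) with hAm
  have hA1 : ev A y₁ < τ := by have := h.AB y₁ hly (hyy'.trans hyu); rwa [hτ] at this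
  have hA2 : ev A y₂ < τ := by have := h.AB y₂ (hly.trans hyy') hyu; rwa [hτ] at this
  have hAτ : Am < τ := max_lt hA1 hA2
  set d : ℝ := (τ : ℝ) - Am with hd
  have hd0 : 0 < d := by rw [hd]; linarith
  have key := (isDN_box h hi hj h1 hn hK (y₁ := y₁) (y₂ := y₂) (a₁ := Am + d / 4) (b₁ := Am + d / 2)
    (a₂ := Am + d / 2) (b₂ := τ) hly.le hyy' hyu.le (fun y h1' h2' => ?_) (by linarith) le_rfl (by linarith)
    (fun y _ _ => by rw [hτ])).2 hcj
  · exact key.2 hκ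
  · exact (ev_le_max_ends A hyy h1'.le h2'.le).trans (by linarith)

end RebaseE2

/-- **Registered brick `rebaseSimpleZero_e2PinchLeft` of the part `HPar1` (stub
`stub_rebaseSimpleZeroTwo`, line `janus-bands`): the pinch at a pole end.** For a datum of the
interval normal form `HDiff₁` (`RebaseE1.IsDN`, both fibres lettered, non-zero base constant)
whose base pole is the LEFT END `l` of the interval, `A(l) = B(l)` (`RebaseE2.pinch_left`: else a
coordinate box next to `y = l` lies in the domain and `∫ dy/|y − l| = ∞`). [Zagier 1994, §9] -/
theorem rebaseSimpleZero_e2PinchLeft (i j : Fin 2) (s : KZ.IntegralRep (0 + 1 + 2)) (l u : ℚ) (A B ci cj : (Fin (0 + 1) → ℚ) × ℚ) (T : RebaseZero.BData) (p : MvPolynomial (Fin 0) ℚ) (a : Fin 2 → Option ((Fin (0 + 1) → ℚ) × ℚ)) (h : RebaseE1.IsDN s l u A B T p a i j) (hi : a i = some ci) (hj : a j = some cj) (h1 : T.n₁ = 0) (hn : T.n₂ = 1) (hK : RebaseDiff.Kc T p ≠ 0) (hr : T.ℓ₂.2 = l) : RebaseZero.ev A l = RebaseZero.ev B l :=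
  RebaseE2.pinch_left h hi hj h1 hn hK hr

end Summit.KontsevichZagierPeriods.ArrangementNormalForm.JanusBands
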